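import Summits.QuantumFields.YangMills.Theorems.InfraredLiouvilleStrongCouplingIRTrivial
import Literature.MathematicalPhysics.QuantumFieldTheory.YangMillsOS
import HarnessLib

/-!
# `ContinuumLegGivenGap` (stmt-QuantumFields-15828) — negative side, lattice half of `FrozenXiFatal`:
# the truncated reflection-diagonal lattice two-point function under a FROZEN correlation length

Support file for the crux item stmt-QuantumFields-15828 (shared decl `ContinuumLegGivenGap`), namespace
`…Theorems.ContinuumLegGivenGap.Negative`; consumed by `Negative/FrozenXiFatal.lean` (the theorem "a frozen
correlation length is fatal for every tamely renormalised witness").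

* §1 `latticeSchwinger_one_eq_mean`, `centredKernel_recentre`, `latticeTrunc_two_eq_sum`,
  `centredKernel_eq_latticeConnectedCorr` — the TRUNCATED smeared lattice two-point function of one species `s` along a
  scheme is `c_k² a_k⁸ ∑ₓ∑_y f(a_k x) g(a_k y) K_k(x, y)` with the EXACTLY centred kernel (the scheme's additive
  counterterm `m_k` cancels in the truncation — no centring hypothesis), and `K_k(x, y)` is the connected torus
  correlation `latticeConnectedCorr ρ β_k (2L_k+1) s (s ∘ τ_z) n` of the crux's own currency at time separation
  `n = y⁰ − x⁰` and purely spatial offset `z` (translation invariance of the torus Wilson state).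
* §2 `site_geometry_of_margin`, `abs_sum_sum_le_of_vanish`, `abs_latticeTrunc_le_of_frozen` — for a real test
  function `w` with time margin `t > 0` vanishing off `B(0, R₀)`, at a step with `a_k ≤ 1`, `a_k L_k ≥ 2R₀` and the
  frozen bound `|corr_k(s, s ∘ τ_z; n)| ≤ C e^{-μ n}` (`z⁰ = 0`, `n ≤ L_k`), the truncated reflection-diagonal
  `⟨Φ_k(θw)Φ_k(w)⟩ − ⟨Φ_k(θw)⟩⟨Φ_k(w)⟩` is at most `c_k² (2R₀+1)⁸ M_w² C e^{-2μt/a_k}` (every contributing pair of sites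
  is at lattice time separation `≥ 2t/a_k` and `≤ L_k`; there are at most `((2R₀+1)/a_k)⁸` of them).

Tree only: `StrongCouplingIRTrivial.TwoPoint` (double-sum form of the lattice two-point function, centred kernel,
`centredKernel_eq_cov`), `YangMillsOS` (`latticeSchwinger`, `latticeConnectedCorr`), `LatticeGaugeProofs`
(translation invariance of the torus Wilson state). References (context): K. Osterwalder, E. Seiler, Ann. Phys. 110
(1978) §2; J. Glimm, A. Jaffe, *Quantum Physics* (1987) §6.1. No definitions, no named facts.
-/

noncomputable section

open scoped SchwartzMap
open MeasureTheory Filter Topology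
open Literature.MathematicalPhysics.AQFT Literature.MathematicalPhysics.QuantumLattice
open Literature.MathematicalPhysics.QuantumFieldTheory
open Literature.Probability.LatticeModels (Site box mem_box card_box)
open Summit.QuantumFields.YangMills.Theorems.StrongCouplingIRTrivial (mem_box_of_norm_smul_le norm_le_of_mem_box)
open Summit.QuantumFields.YangMills.Theorems.StrongCouplingIRTrivial.TwoPoint (centredKernel latticeSchwinger_two_eq
  centredKernel_eq_cov integrable_shift_lift configShift_configShift)

namespace Summit.QuantumFields.YangMills.Theorems.ContinuumLegGivenGap.Negative

/-! ## §1 Lattice identities: the truncated two-point function as a double sum over the exactly centred kernel -/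

section Lattice

variable {G : Type} [Group G] [TopologicalSpace G] [IsTopologicalGroup G] [CompactSpace G]
  [MeasurableSpace G] [BorelSpace G]

/-- Translation invariance of the torus Wilson state, integral form: the mean of a shifted lifted observable is the
torus mean. [folklore] -/
theorem integral_comp_configShift_torusLift (r : LatticeRep G) (β : ℝ) (S : ℕ) [NeZero S]
    (F : LGConfig 4 G → ℝ) (v : Site 4) :
    ∫ U : GaugeConfig 4 S G, F (configShift v (torusLift S U)) ∂(wilsonMeasure (d := 4) (L := S) r.ρ β) =
      wilsonExpectation (L := S) r.ρ β (toTorusObservable S F) := by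
  have h := wilsonExpectation_comp_torusConfigShift (d := 4) (L := S) r.ρ β
    (Literature.Probability.LatticeModels.Torus.proj S v) (toTorusObservable S F)
  rw [← toTorusObservable_comp_configShift] at h
  exact h

/-- **The degree-one lattice function, exactly**: for one real test function `f`,
`latticeSchwinger … k 1 s ![f] = c_k a_k⁴ (∑_{x ∈ box} f(a_k x)) (⟨s⟩_k − m_k)`, `⟨s⟩_k` the torus Wilson mean of the
species (site-independent by translation invariance). [folklore] -/
theorem latticeSchwinger_one_eq_mean (r : LatticeRep G) (sch : SpeciesScheme (YMSpecies G)) (s : YMSpecies G)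
    (k : ℕ) (f : 𝓢(EuclideanSpace ℝ (Fin 4), ℝ)) :
    latticeSchwinger r.ρ sch (fun s => s.F) k 1 (fun _ => s) ![f] =
      sch.c s k * sch.a k ^ 4 * (∑ x ∈ box 4 (sch.L k), f (sch.a k • siteToE x)) *
        (wilsonExpectation (L := sch.side k) r.ρ (sch.β k) (toTorusObservable (sch.side k) s.F) - sch.m s k) := by
  haveI := isProbabilityMeasure_wilsonMeasure (d := 4) (L := sch.side k) r.ρ r.continuous (sch.β k)
  have hI : ∀ x : Site 4, Integrable (fun U : GaugeConfig 4 (sch.side k) G =>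
      s.F (configShift (-x) (torusLift (sch.side k) U)) - sch.m s k)
      (wilsonMeasure (d := 4) (L := sch.side k) r.ρ (sch.β k)) :=
    fun x => integrable_shift_lift r.ρ r.continuous _ _ s.measurable s.bounded x _
  have hmean : ∀ x : Site 4, ∫ U : GaugeConfig 4 (sch.side k) G,
      (s.F (configShift (-x) (torusLift (sch.side k) U)) - sch.m s k)
        ∂(wilsonMeasure (d := 4) (L := sch.side k) r.ρ (sch.β k)) =
      wilsonExpectation (L := sch.side k) r.ρ (sch.β k) (toTorusObservable (sch.side k) s.F) - sch.m s k := by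
    intro x
    have h0 : Integrable (fun U : GaugeConfig 4 (sch.side k) G => s.F (configShift (-x) (torusLift (sch.side k) U)))
        (wilsonMeasure (d := 4) (L := sch.side k) r.ρ (sch.β k)) := by
      simpa using integrable_shift_lift r.ρ r.continuous (sch.β k) (sch.side k) s.measurable s.bounded x 0
    rw [integral_sub h0 (integrable_const _), integral_const, probReal_univ, one_smul,
      integral_comp_configShift_torusLift]
  unfold latticeSchwinger
  simp only [Fin.prod_univ_one, Matrix.cons_val_fin_one, smearedLatticeField]
  rw [integral_const_mul, integral_finsetSum _ (fun x _ => (hI x).const_mul _)]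
  simp_rw [integral_const_mul, hmean]
  rw [← Finset.sum_mul]
  ring

/-- **Re-centring the kernel**: the kernel centred at the scheme's counterterm `m` differs from the EXACTLY centred
kernel (centred at the torus mean `⟨s⟩`) by the constant `(⟨s⟩ − m)²`. [folklore] -/
theorem centredKernel_recentre (r : LatticeRep G) (β : ℝ) (S : ℕ) [NeZero S] (s : YMSpecies G) (m : ℝ)
    (x y : Site 4) :
    centredKernel r.ρ β S s.F s.F m m x y =
      centredKernel r.ρ β S s.F s.F (wilsonExpectation (L := S) r.ρ β (toTorusObservable S s.F))
          (wilsonExpectation (L := S) r.ρ β (toTorusObservable S s.F)) x y +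
        (wilsonExpectation (L := S) r.ρ β (toTorusObservable S s.F) - m) ^ 2 := by
  haveI := isProbabilityMeasure_wilsonMeasure (d := 4) (L := S) r.ρ r.continuous β
  set μ := wilsonMeasure (d := 4) (L := S) r.ρ β with hμ
  set Obar := wilsonExpectation (L := S) r.ρ β (toTorusObservable S s.F) with hObar
  set A : GaugeConfig 4 S G → ℝ := fun U => s.F (configShift (-x) (torusLift S U)) with hA
  set B : GaugeConfig 4 S G → ℝ := fun U => s.F (configShift (-y) (torusLift S U)) with hB
  have hIA : Integrable A μ := by simpa using integrable_shift_lift r.ρ r.continuous β S s.measurable s.bounded x 0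
  have hIB : Integrable B μ := by simpa using integrable_shift_lift r.ρ r.continuous β S s.measurable s.bounded y 0
  have hIAB : Integrable (fun U => A U * B U) μ := by
    obtain ⟨C₁, hC₁⟩ := s.bounded
    refine hIA.mul_bdd hIB.aestronglyMeasurable (c := C₁) (ae_of_all _ fun U => ?_)
    rw [Real.norm_eq_abs]
    exact hC₁ _
  have hEA : ∫ U, A U ∂μ = Obar := integral_comp_configShift_torusLift r β S s.F (-x)
  have hEB : ∫ U, B U ∂μ = Obar := integral_comp_configShift_torusLift r β S s.F (-y)
  -- the generic expansion `∫ (A - p)(B - q) = ∫ A B - p ∫ B - q ∫ A + p q`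
  have hexp : ∀ p q : ℝ, ∫ U, (A U - p) * (B U - q) ∂μ = ∫ U, A U * B U ∂μ - p * Obar - q * Obar + p * q := by
    intro p q
    have hfun : (fun U => (A U - p) * (B U - q)) = fun U => A U * B U - p * B U - q * A U + p * q := by
      funext U; ring
    have hI1 : Integrable (fun U => A U * B U - p * B U) μ := hIAB.sub (hIB.const_mul p)
    have hI2 : Integrable (fun U => A U * B U - p * B U - q * A U) μ := hI1.sub (hIA.const_mul q)
    rw [hfun, integral_add hI2 (integrable_const _), integral_sub hI1 (hIA.const_mul q),
      integral_sub hIAB (hIB.const_mul p), integral_const_mul, integral_const_mul, integral_const,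
      probReal_univ, one_smul, hEA, hEB]
  unfold centredKernel
  rw [show (fun U => (s.F (configShift (-x) (torusLift S U)) - m) * (s.F (configShift (-y) (torusLift S U)) - m)) =
      fun U => (A U - m) * (B U - m) from rfl,
    show (fun U => (s.F (configShift (-x) (torusLift S U)) - Obar) * (s.F (configShift (-y) (torusLift S U)) - Obar)) =
      fun U => (A U - Obar) * (B U - Obar) from rfl, hexp, hexp]
  ring

/-- **The truncated lattice two-point function as a double sum over the EXACTLY centred kernel** (the scheme's additive
counterterm cancels): `⟨Φ(f)Φ(g)⟩ − ⟨Φ(f)⟩⟨Φ(g)⟩ = c_k² a_k⁸ ∑ₓ ∑_y f(a_k x) g(a_k y) K_k(x, y)`. [folklore] -/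
theorem latticeTrunc_two_eq_sum (r : LatticeRep G) (sch : SpeciesScheme (YMSpecies G)) (s : YMSpecies G) (k : ℕ)
    (f g : 𝓢(EuclideanSpace ℝ (Fin 4), ℝ)) :
    latticeSchwinger r.ρ sch (fun s => s.F) k 2 (fun _ => s) ![f, g] -
        latticeSchwinger r.ρ sch (fun s => s.F) k 1 (fun _ => s) ![f] *
          latticeSchwinger r.ρ sch (fun s => s.F) k 1 (fun _ => s) ![g] =
      sch.c s k ^ 2 * sch.a k ^ 8 *
        ∑ x ∈ box 4 (sch.L k), ∑ y ∈ box 4 (sch.L k), f (sch.a k • siteToE x) * g (sch.a k • siteToE y) *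
          centredKernel r.ρ (sch.β k) (sch.side k) s.F s.F
            (wilsonExpectation (L := sch.side k) r.ρ (sch.β k) (toTorusObservable (sch.side k) s.F))
            (wilsonExpectation (L := sch.side k) r.ρ (sch.β k) (toTorusObservable (sch.side k) s.F)) x y := by
  rw [latticeSchwinger_two_eq r.ρ r.continuous sch (fun s => s.F) k (fun _ => s) ![f, g]
      (fun _ => s.measurable) (fun _ => s.bounded),
    latticeSchwinger_one_eq_mean, latticeSchwinger_one_eq_mean]
  simp only [Matrix.cons_val_zero, Matrix.cons_val_one, Matrix.cons_val_fin_one]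
  set Obar := wilsonExpectation (L := sch.side k) r.ρ (sch.β k) (toTorusObservable (sch.side k) s.F) with hObar
  set m := sch.m s k with hm
  set a := sch.a k with ha
  set B := box 4 (sch.L k) with hB
  have hK : ∀ x y : Site 4, centredKernel r.ρ (sch.β k) (sch.side k) s.F s.F m m x y =
      centredKernel r.ρ (sch.β k) (sch.side k) s.F s.F Obar Obar x y + (Obar - m) ^ 2 :=
    fun x y => centredKernel_recentre r (sch.β k) (sch.side k) s m x y
  have hsplit : ∑ x ∈ B, ∑ y ∈ B, f (a • siteToE x) * g (a • siteToE y) *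
        centredKernel r.ρ (sch.β k) (sch.side k) s.F s.F m m x y =
      ∑ x ∈ B, ∑ y ∈ B, f (a • siteToE x) * g (a • siteToE y) *
          centredKernel r.ρ (sch.β k) (sch.side k) s.F s.F Obar Obar x y +
        (∑ x ∈ B, f (a • siteToE x)) * (∑ y ∈ B, g (a • siteToE y)) * (Obar - m) ^ 2 := by
    rw [Finset.sum_mul_sum, Finset.sum_mul, ← Finset.sum_add_distrib]
    refine Finset.sum_congr rfl fun x _ => ?_
    rw [Finset.sum_mul, ← Finset.sum_add_distrib]
    refine Finset.sum_congr rfl fun y _ => ?_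
    rw [hK x y]
    ring
  rw [hsplit]
  ring

/-- **The exactly centred kernel is a connected time correlation of the crux's currency**: for sites `x, y` at
lattice time separation `y⁰ − x⁰ = n ≥ 0`, `K(x, y) = latticeConnectedCorr ρ β S s (s ∘ τ_z) n` with the purely
SPATIAL offset `z = x − y + n e₀` (`z⁰ = 0`). [folklore] -/
theorem centredKernel_eq_latticeConnectedCorr (r : LatticeRep G) (β : ℝ) (S : ℕ) [NeZero S] (s : YMSpecies G)
    (x y : Site 4) (n : ℕ) :
    centredKernel r.ρ β S s.F s.F (wilsonExpectation (L := S) r.ρ β (toTorusObservable S s.F))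
        (wilsonExpectation (L := S) r.ρ β (toTorusObservable S s.F)) x y =
      latticeConnectedCorr r.ρ β S s.F (s.F ∘ configShift (x - y + Pi.single 0 (n : ℤ))) n := by
  rw [centredKernel_eq_cov r.ρ r.continuous β S s.measurable s.measurable s.bounded s.bounded rfl rfl x y]
  have h3 : wilsonExpectation (L := S) r.ρ β (toTorusObservable S (s.F ∘ configShift (x - y))) =
      wilsonExpectation (L := S) r.ρ β (toTorusObservable S s.F) :=
    integral_comp_configShift_torusLift r β S s.F (x - y)
  have h4 : ∫ U : GaugeConfig 4 S G, (s.F ∘ configShift (x - y + Pi.single 0 (n : ℤ))) (torusLift S U)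
      ∂(wilsonMeasure (d := 4) (L := S) r.ρ β) = wilsonExpectation (L := S) r.ρ β (toTorusObservable S s.F) :=
    integral_comp_configShift_torusLift r β S s.F _
  have h5 : ∀ U : GaugeConfig 4 S G, (s.F ∘ configShift (x - y + Pi.single 0 (n : ℤ)))
      (configShift (-Pi.single 0 (n : ℤ)) (torusLift S U)) = s.F (configShift (x - y) (torusLift S U)) := by
    intro U
    simp only [Function.comp_apply, configShift_configShift, add_neg_cancel_right]
  unfold latticeConnectedCorr
  simp_rw [h5]
  rw [h4, h3]
  rfl

end Lattice

/-! ## §2 The frozen bound on the reflection-diagonal truncated lattice two-point function -/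

section Frozen

variable {G : Type} [Group G] [TopologicalSpace G] [IsTopologicalGroup G] [CompactSpace G]
  [MeasurableSpace G] [BorelSpace G]

/-- Geometry of a compactly supported test function with a time margin, read on the rescaled lattice: if
`supp w ⊆ {t ≤ y⁰}` and `w` vanishes off the ball `B(0, R₀)`, then a site `y` with `w(a y) ≠ 0` has `t ≤ a y⁰` and
lies in `box 4 ⌊R₀/a⌋₊`, and a site `x` with `(Θw)(a x) ≠ 0` has `a x⁰ ≤ −t` and lies in the same box. [folklore] -/
theorem site_geometry_of_margin {w : 𝓢(EuclideanSpace ℝ (Fin 4), ℝ)} {t R₀ a : ℝ} (ha : 0 < a)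
    (hmargin : tsupport (w : EuclideanSpace ℝ (Fin 4) → ℝ) ⊆ {y | t ≤ y 0})
    (hball : ∀ z, w z ≠ 0 → ‖z‖ ≤ R₀) :
    (∀ y : Site 4, w (a • siteToE y) ≠ 0 → t ≤ a * y 0 ∧ y ∈ box 4 ⌊R₀ / a⌋₊) ∧
    (∀ x : Site 4, thetaTest 4 w (a • siteToE x) ≠ 0 → a * x 0 ≤ -t ∧ x ∈ box 4 ⌊R₀ / a⌋₊) := by
  have hcoord : ∀ y : Site 4, (a • siteToE y) 0 = a * y 0 := fun y => by simp [siteToE_apply]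
  constructor
  · intro y hy
    refine ⟨?_, mem_box_of_norm_smul_le ha (hball _ hy)⟩
    have hmem : t ≤ (a • siteToE y) 0 := hmargin (subset_tsupport _ hy)
    rwa [hcoord] at hmem
  · intro x hx
    rw [thetaTest_apply] at hx
    refine ⟨?_, ?_⟩
    · have hmem : t ≤ (timeReflection 4 (a • siteToE x)) 0 := hmargin (subset_tsupport _ hx)
      have hrefl : (timeReflection 4 (a • siteToE x)) 0 = -(a * x 0) := by
        simp [timeReflection_apply, siteToE_apply]
      rw [hrefl] at hmem
      linarith
    · have h := hball _ hx
      rw [LinearIsometryEquiv.norm_map] at h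
      exact mem_box_of_norm_smul_le ha h

/-- Double-sum bookkeeping: a real kernel on `S × S` that vanishes off `s × s` (`s ⊆ S`) and is bounded by `M` in
modulus has `|∑_{S × S} F| ≤ (#s)² M`. [folklore] -/
theorem abs_sum_sum_le_of_vanish {α : Type*} {S s₀ : Finset α} (hsub : s₀ ⊆ S) (F : α → α → ℝ) {M : ℝ}
    (hx : ∀ x ∈ S, x ∉ s₀ → ∀ y, F x y = 0) (hy : ∀ y ∈ S, y ∉ s₀ → ∀ x, F x y = 0)
    (hM : ∀ x y, |F x y| ≤ M) :
    |∑ x ∈ S, ∑ y ∈ S, F x y| ≤ s₀.card * (s₀.card * M) := by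
  have hrestrict : ∑ x ∈ S, ∑ y ∈ S, F x y = ∑ x ∈ s₀, ∑ y ∈ s₀, F x y := by
    symm
    refine (Finset.sum_subset hsub fun x hxS hxs => ?_).trans (Finset.sum_congr rfl fun x _ => ?_)
    · exact Finset.sum_eq_zero fun y _ => hx x hxS hxs y
    · exact Finset.sum_subset hsub fun y hyS hys => hy y hyS hys x
  rw [hrestrict]
  refine (Finset.abs_sum_le_sum_abs _ _).trans ?_
  refine (Finset.sum_le_sum fun x _ => (Finset.abs_sum_le_sum_abs _ _).trans
    (Finset.sum_le_sum fun y _ => hM x y)).trans ?_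
  rw [Finset.sum_const, nsmul_eq_mul, Finset.sum_const, nsmul_eq_mul]

/-- **The frozen bound.** For a real test function `w` with time margin `t > 0` vanishing off `B(0, R₀)`, at a step
`k` with `a_k ≤ 1`, `a_k L_k ≥ 2R₀` at which the connected torus correlations of `s` with its spatial-and-time
translates obey the frozen bound `|corr_k(s, s ∘ τ_z; n)| ≤ C e^{-μ n}` (`z⁰ = 0`, `n ≤ L_k`), the truncated
reflection-diagonal lattice two-point function of the smeared species is at most
`c_k² (2R₀+1)⁸ M_w² C · e^{-2μt/a_k}`: every contributing pair of sites is at lattice time separation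
`≥ 2t/a_k` (and `≤ L_k`), and there are at most `((2R₀+1)/a_k)⁸` of them. [folklore] -/
theorem abs_latticeTrunc_le_of_frozen (r : LatticeRep G) (sch : SpeciesScheme (YMSpecies G)) (s : YMSpecies G)
    {μ C t R₀ Mw : ℝ} (hμ : 0 < μ) (hC : 0 ≤ C) (ht : 0 < t) (hR₀ : 0 ≤ R₀)
    {w : 𝓢(EuclideanSpace ℝ (Fin 4), ℝ)}
    (hmargin : tsupport (w : EuclideanSpace ℝ (Fin 4) → ℝ) ⊆ {y | t ≤ y 0}) (hball : ∀ z, w z ≠ 0 → ‖z‖ ≤ R₀)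
    (hMw : ∀ z, |w z| ≤ Mw) (k : ℕ) (hk1 : sch.a k ≤ 1) (hk2 : 2 * R₀ ≤ sch.a k * sch.L k)
    (hfro : ∀ (z : Site 4) (n : ℕ), z 0 = 0 → n ≤ sch.L k →
      |latticeConnectedCorr r.ρ (sch.β k) (2 * sch.L k + 1) s.F (s.F ∘ configShift z) n| ≤
        C * Real.exp (-(μ * n))) :
    |latticeSchwinger r.ρ sch (fun s => s.F) k 2 (fun _ => s) ![thetaTest 4 w, w] -
        latticeSchwinger r.ρ sch (fun s => s.F) k 1 (fun _ => s) ![thetaTest 4 w] *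
          latticeSchwinger r.ρ sch (fun s => s.F) k 1 (fun _ => s) ![w]| ≤
      sch.c s k ^ 2 * ((2 * R₀ + 1) ^ 8 * Mw ^ 2 * C) * Real.exp (-(2 * μ * t * (sch.a k)⁻¹)) := by
  rw [latticeTrunc_two_eq_sum]
  set a := sch.a k with ha_def
  set L := sch.L k with hL_def
  set N : ℕ := ⌊R₀ / a⌋₊ with hN_def
  set E : ℝ := Real.exp (-(2 * μ * t * a⁻¹)) with hE_def
  set Obar := wilsonExpectation (L := sch.side k) r.ρ (sch.β k) (toTorusObservable (sch.side k) s.F) with hObar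
  have ha : 0 < a := sch.a_pos k
  have hMw0 : 0 ≤ Mw := (abs_nonneg _).trans (hMw 0)
  have hE0 : 0 < E := Real.exp_pos _
  obtain ⟨hgeo_w, hgeo_θ⟩ := site_geometry_of_margin (R₀ := R₀) ha hmargin hball
  have hNa : (N : ℝ) ≤ R₀ / a := Nat.floor_le (div_nonneg hR₀ ha.le)
  have h2N : 2 * (N : ℝ) ≤ L := by
    have h2 : 2 * (R₀ / a) ≤ L := by rw [mul_div_assoc', div_le_iff₀ ha]; linarith [hk2]
    linarith
  -- the kernel bound on contributing pairs of sites
  have hker : ∀ x y : Site 4, thetaTest 4 w (a • siteToE x) ≠ 0 → w (a • siteToE y) ≠ 0 →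
      |centredKernel r.ρ (sch.β k) (sch.side k) s.F s.F Obar Obar x y| ≤ C * E := by
    intro x y hx hy
    obtain ⟨hx0, hxB⟩ := hgeo_θ x hx
    obtain ⟨hy0, hyB⟩ := hgeo_w y hy
    have hgap : 2 * t ≤ a * ((y 0 : ℝ) - (x 0 : ℝ)) := by nlinarith
    have hpos : (0 : ℝ) < (y 0 : ℝ) - (x 0 : ℝ) := by
      by_contra hle
      push Not at hle
      nlinarith
    have hn0 : (0 : ℤ) ≤ y 0 - x 0 := by exact_mod_cast hpos.le
    obtain ⟨n, hn⟩ := Int.eq_ofNat_of_zero_le hn0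
    have hxN := (mem_box.1 hxB) 0
    have hyN := (mem_box.1 hyB) 0
    have hn2N : (n : ℤ) ≤ 2 * N := by omega
    have hnL : n ≤ L := by
      have : (n : ℝ) ≤ L := by
        have h1 : ((n : ℤ) : ℝ) ≤ ((2 * N : ℤ) : ℝ) := by exact_mod_cast hn2N
        push_cast at h1
        linarith
      exact_mod_cast this
    have hz : (x - y + Pi.single (0 : Fin 4) (n : ℤ) : Site 4) 0 = 0 := by
      simp only [Pi.add_apply, Pi.sub_apply, Pi.single_eq_same]; omega
    have hncast : ((y 0 : ℤ) : ℝ) - ((x 0 : ℤ) : ℝ) = (n : ℝ) := by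
      have := congrArg (fun z : ℤ => (z : ℝ)) hn; push_cast at this; exact this
    rw [centredKernel_eq_latticeConnectedCorr r (sch.β k) (sch.side k) s x y n]
    refine (hfro _ n hz hnL).trans (mul_le_mul_of_nonneg_left (Real.exp_le_exp.2 ?_) hC)
    rw [neg_le_neg_iff]
    have h1 : 2 * μ * t ≤ μ * n * a := by
      have h2 := mul_le_mul_of_nonneg_left hgap hμ.le
      rw [hncast] at h2
      nlinarith
    calc 2 * μ * t * a⁻¹ ≤ μ * ↑n * a * a⁻¹ := by gcongr
      _ = μ * ↑n := by field_simp
  -- restrict both sums to the small box (the weights vanish outside it) and bound termwise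
  have hNL : N ≤ L := by
    have : (N : ℝ) ≤ L := by linarith [(Nat.cast_nonneg N : (0 : ℝ) ≤ N)]
    exact_mod_cast this
  have hsub : box 4 N ⊆ box 4 L := Literature.Probability.LatticeModels.box_mono 4 hNL
  have hsum := abs_sum_sum_le_of_vanish hsub (fun x y => thetaTest 4 w (a • siteToE x) * w (a • siteToE y) *
      centredKernel r.ρ (sch.β k) (sch.side k) s.F s.F Obar Obar x y) (M := Mw * (Mw * (C * E)))
    (fun x _ hx y => by
      have h0 : thetaTest 4 w (a • siteToE x) = 0 := by by_contra h; exact hx (hgeo_θ x h).2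
      simp [h0])
    (fun y _ hy x => by
      have h0 : w (a • siteToE y) = 0 := by by_contra h; exact hy (hgeo_w y h).2
      simp [h0])
    (fun x y => by
      have hrhs : 0 ≤ Mw * (Mw * (C * E)) := by positivity
      by_cases hx : thetaTest 4 w (a • siteToE x) = 0
      · simpa [hx] using hrhs
      by_cases hy : w (a • siteToE y) = 0
      · simpa [hy] using hrhs
      have h1 : |thetaTest 4 w (a • siteToE x)| ≤ Mw := by rw [thetaTest_apply]; exact hMw _
      have h2 : |w (a • siteToE y)| ≤ Mw := hMw _
      have h3 := hker x y hx hy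
      rw [abs_mul, abs_mul]
      calc |thetaTest 4 w (a • siteToE x)| * |w (a • siteToE y)| *
            |centredKernel r.ρ (sch.β k) (sch.side k) s.F s.F Obar Obar x y| ≤ Mw * Mw * (C * E) := by
            gcongr
        _ = Mw * (Mw * (C * E)) := by ring)
  have hcardR : a ^ 4 * ((box 4 N).card : ℝ) ≤ (2 * R₀ + 1) ^ 4 := by
    rw [card_box]
    push_cast
    have haN : a * N ≤ R₀ := by
      have := (le_div_iff₀ ha).1 hNa
      linarith [mul_comm (N : ℝ) a]
    have h1 : a * (2 * N + 1) ≤ 2 * R₀ + 1 := by nlinarith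
    calc a ^ 4 * (2 * (N : ℝ) + 1) ^ 4 = (a * (2 * N + 1)) ^ 4 := by ring
      _ ≤ (2 * R₀ + 1) ^ 4 := by gcongr
  rw [abs_mul, abs_mul, abs_of_nonneg (sq_nonneg _), abs_of_pos (pow_pos ha 8)]
  calc sch.c s k ^ 2 * a ^ 8 * |∑ x ∈ box 4 L, ∑ y ∈ box 4 L, thetaTest 4 w (a • siteToE x) * w (a • siteToE y) *
          centredKernel r.ρ (sch.β k) (sch.side k) s.F s.F Obar Obar x y|
      ≤ sch.c s k ^ 2 * a ^ 8 * (((box 4 N).card : ℝ) * (((box 4 N).card : ℝ) * (Mw * (Mw * (C * E))))) := by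
        gcongr
    _ = sch.c s k ^ 2 * (a ^ 4 * ((box 4 N).card : ℝ)) ^ 2 * Mw ^ 2 * C * E := by ring
    _ ≤ sch.c s k ^ 2 * ((2 * R₀ + 1) ^ 4) ^ 2 * Mw ^ 2 * C * E := by gcongr
    _ = sch.c s k ^ 2 * ((2 * R₀ + 1) ^ 8 * Mw ^ 2 * C) * E := by ring

end Frozen

end Summit.QuantumFields.YangMills.Theorems.ContinuumLegGivenGap.Negative

end
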